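import Summits.HodgeConjecture.HodgeConjecture.Theorems.R90S6TypeTwoCayleyBlockOdd     -- ★∕pending B1-odd (this seat): `blockFrame_of_typeTwo_odd`, `cayleyBlock_two_odd`; brings ★ B1∕B2 and the ★ Möbius toolbox
import HarnessLib

/-!
# R90 · S6 — LINE G1 «geometric fixed subtree», RUNG 2 ODD EDITION, FILE B2: THE CAYLEY SHIFT OF A TYPE-(2) ELEMENT WITH ODD EIGENLINE — `Y = φ_ϖ(u⁻¹γ) ∈ U`,
# same eigenvector, exponents `(n, N) ↦ (n−2, N−1)`, the shifted-order memberships of ★ ROW 0; and `χ_γ ≡ (X − u)³` (`Theorems/R90S6TypeTwoCayleyShiftOdd.lean`)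

Cell `hodgecm-mathlib`, crux H413 (`stmt-HodgeConjecture-24833`), route of record `HCCMUnconditional`; programme R90-TF, section S6 (base `R90-C14`), seat R90-C14-p07 (g2,
heir of g0); S6 dealer R90-C14-plan (g2) CARD (G2-ODD) «G1 RUNG 2 ODD EDITION» (2026-09-05T02:52:41Z; census 02:56:51Z «=», GO 02:58:02Z): FILE B2 = the ODD twins of
★ B2's (R2.c) `exists_cayleyShift_of_typeTwo` and (R2.d) `norm_eq_one_and_charpoly_congr_of_typeTwo` (`Theorems/R90S6TypeTwoCayleyShift.lean`, p864392) — binders BYTE FOR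
BYTE with `hx : v (B₀ σ 3 x x) = exp (2k+1)` in place of `exp (2k)`.  Helper lane `--supports stmt-HodgeConjecture-24833 --as helper`; THEOREMS ONLY (no definition, no
instance, no notation, no named fact, no `sorry`); imports = B1-odd `R90S6TypeTwoCayleyBlockOdd` + HarnessLib.

THE MATHEMATICS [Kottwitz1986BaseChangeUnits, §1 pp. 240–241; Rogawski1990, §4.9 Prop. 4.9.1 (b) p. 55; Flicker1998UnitaryFL, §6, Prop. 16 p. 96, Theorem 18 p. 97;
Weyl1939, Chap. II §10; Lang2002, Ch. XIV §3].  With the block-frame data of B1-odd (`u⁻¹γ = P·pattern(g₂, 1)·P⁻¹`, `g₂ = (A q; 4ϖr s)` the anisotropic `2 × 2` model,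
`X₂ = ϖ⁻¹(g₂ − 1)` integral, cofactors `det(2 + (ϖ∓1)X₂)` units, Möbius block `Φ` with exponents `(n−2, N−1)`): (R2.c)-ODD — `W = ϖ⁻¹(u⁻¹γ − 1) = P·pattern(X₂, 0)·P⁻¹`,
`N± = 2 + (ϖ±1)W = P·pattern(2 + (ϖ±1)X₂, 2)·P⁻¹` have unit determinants, `Y := N₊N₋⁻¹ = φ_ϖ(W) = P·pattern(Φ, 1)·P⁻¹` is UNITARY (★ `transpose_map_moebius_mul_mul`: `u⁻¹γ`
is unitary as `σu·u = 1`, `ϖ ± 1` are `σ`-fixed), fixes `x` (`Wx = 0`, `N±x = 2x`), has `tr Y = tr Φ + 1`, `det Y = det Φ`, and the memberships `Y, Y⁻¹ ∈ 𝒪[1+W]`, `1+W ∈ 𝒪[Y]`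
hold in the block frame (★ `moebius_mem_adjoin`, `moebius_inv_mem_adjoin`, `mem_adjoin_moebius`, `W″` integral) and are transported by ★ B2 `conj_mem_adjoin_conj` (ANY
invertible `P` — the frame is not integral and need not be).  (R2.d)-ODD — `σu·u = 1`, `|u| = 1`, and `χ_γ = χ_{u·pattern(g₂,1)}` (`Matrix.charpoly_units_conj`) with
`u·pattern(g₂,1) − u·1 = ϖ·(u·pattern(X₂,0))` integral, so `χ_γ ≡ χ_{u·1} = (X − u)³ (mod 𝔪)` coefficientwise (★ `v_inv_mul_charpoly_coeff_sub_le_one`).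
HONEST LABEL: assemblies over ★ abstract lemmas in S6's letters; count-neutral; consumed by FILE C (the odd closed form `a₁ + phiTHprimen = 1 + S·phiTHprimen`).  HC_CM is
proved only modulo the 7 printed citations (2 remaining named inputs: hLiu418 = stmt-HodgeConjecture-24832, h413 = stmt-HodgeConjecture-24833) until rung 0 closes.

## References
* [Kottwitz1986BaseChangeUnits] R. E. Kottwitz, *Base change for unit elements of Hecke algebras*, Compositio Math. 60 (1986) 237–250, §1 pp. 240–241.
* [Rogawski1990] J. D. Rogawski, *Automorphic Representations of Unitary Groups in Three Variables*, Ann. of Math. Stud. 123 (1990), §4.9 Prop. 4.9.1 (b) p. 55.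
* [Flicker1998UnitaryFL] Y. Z. Flicker, *Elementary proof of the fundamental lemma for a unitary group*, Canad. J. Math. 50 (1998), §6; Prop. 16 p. 96; Theorem 18 p. 97.
* [Weyl1939] H. Weyl, *The Classical Groups* (1939), Chap. II §10 (Cayley's rational parametrisation).
* [Lang2002] S. Lang, *Algebra*, 3rd ed. (2002), Ch. XIV §3 (characteristic polynomial under reduction).
-/
set_option autoImplicit false
-- the mandated namespace repeats the single-problem summit's segment (`HodgeConjecture.HodgeConjecture`)
set_option linter.dupNamespace false

noncomputable section

open Matrix Polynomial
open Literature.NumberTheory.Automorphic Literature.NumberTheory.Automorphic.HermitianLattice Literature.NumberTheory.Automorphic.UnitaryGroup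
open Literature.NumberTheory.Automorphic.MoebiusShift Literature.NumberTheory.Automorphic.UnitaryLatticeTree
open scoped Matrix MatrixGroups WithZero ValuativeRel

namespace Summit.HodgeConjecture.HodgeConjecture.R90.S6

section ShiftOdd

variable {K : Type*} [Field K] [Valued K ℤᵐ⁰]

set_option maxHeartbeats 800000 in
-- six transported conjuncts, the unitarity transport and the block bookkeeping in one proof (same budget as ★ B2 (R2.c))
/-- **G1 RUNG 2 (R2.c), ODD EDITION — THE CAYLEY SHIFT OF A TYPE-(2) ELEMENT WITH ODD EIGENLINE.**  For a type-(2) `γ ∈ U(σ, J₀)(K)` (anisotropic eigenvector `x`,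
`γx = ux`, `|B₀(x,x)| = |ϖ|^{2k+1}` ODD; exponents `|(tr γ − u)² − 4 det γ∕u| = |ϖ^{2N+1}|`, `|u² − (tr γ − u)u + det γ∕u| = |ϖ^n|`, `2 ≤ n`, `1 ≤ N`) there is `Y ∈ U` — the
Cayley∕Möbius shift `φ_ϖ(u⁻¹γ) = (2 + (ϖ+1)W)(2 + (ϖ−1)W)⁻¹`, `W = ϖ⁻¹(u⁻¹γ − 1)`, unitary by ★ `transpose_map_moebius_mul_mul`, computed in the block frame of B1-odd — with
`Yx = x`, exponents `(n−2, N−1)` in ★ a₀'s spelling (at eigenvalue `1`), and the three shifted-order memberships of ★ ROW 0: `Y, Y⁻¹ ∈ 𝒪[X]`, `X ∈ 𝒪[Y]`,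
`X = 1 + ϖ⁻¹(u⁻¹γ − 1)`.  Binders = ★ B2 (R2.c) with `hx` odd.
[cite: Kottwitz1986BaseChangeUnits, §1 pp. 240–241] [cite: Rogawski1990, §4.9 Prop. 4.9.1 (b) p. 55] [cite: Flicker1998UnitaryFL, §6; Prop. 16 p. 96; Theorem 18 p. 97] -/
theorem exists_cayleyShift_of_typeTwo_odd [ValuativeRel K] [(Valued.v : Valuation K ℤᵐ⁰).Compatible]
    [IsDiscreteValuationRing (Valued.integer K)] [Finite (IsLocalRing.ResidueField (Valued.integer K))]
    [IsAdicComplete (IsLocalRing.maximalIdeal (Valued.integer K)) (Valued.integer K)]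
    {σ : K →+* K} {ϖ : K} (hd : LocalConjDatum σ ϖ)
    (hσO : ∀ y : Valued.integer K, (σ.comp (Valued.integer K).subtype) y ∈ Valued.integer K)
    {a₀ : Valued.integer K} (ha₀ : IsUnit (((σ.comp (Valued.integer K).subtype).codRestrict (Valued.integer K) hσO) a₀ - a₀))
    {γ : ↥(unitaryGroupOfForm σ ((StdForm.antidiagonal 3).over K))} {x : Fin 3 → K} {u : K}
    (hγx : (((γ : ↥(unitaryGroupOfForm σ ((StdForm.antidiagonal 3).over K))) : GL (Fin 3) K) : Matrix (Fin 3) (Fin 3) K) *ᵥ x = u • x)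
    {k : ℤ} (hx : Valued.v (B₀ σ 3 x x) = WithZero.exp (2 * k + 1))
    {N n : ℕ} (hN : Valued.v ((Matrix.trace (((γ : ↥(unitaryGroupOfForm σ ((StdForm.antidiagonal 3).over K))) : GL (Fin 3) K) : Matrix (Fin 3) (Fin 3) K) - u) ^ 2 -
      4 * (Matrix.det (((γ : ↥(unitaryGroupOfForm σ ((StdForm.antidiagonal 3).over K))) : GL (Fin 3) K) : Matrix (Fin 3) (Fin 3) K) / u)) = Valued.v (ϖ ^ (2 * N + 1)))
    (hn : Valued.v (u ^ 2 - (Matrix.trace (((γ : ↥(unitaryGroupOfForm σ ((StdForm.antidiagonal 3).over K))) : GL (Fin 3) K) : Matrix (Fin 3) (Fin 3) K) - u) * u +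
      Matrix.det (((γ : ↥(unitaryGroupOfForm σ ((StdForm.antidiagonal 3).over K))) : GL (Fin 3) K) : Matrix (Fin 3) (Fin 3) K) / u) = Valued.v (ϖ ^ n))
    (hn2 : 2 ≤ n) (hN1 : 1 ≤ N) :
    ∃ Y : ↥(unitaryGroupOfForm σ ((StdForm.antidiagonal 3).over K)),
      ((Y : GL (Fin 3) K) : Matrix (Fin 3) (Fin 3) K) *ᵥ x = (1 : K) • x ∧
      Valued.v ((Matrix.trace ((Y : GL (Fin 3) K) : Matrix (Fin 3) (Fin 3) K) - 1) ^ 2 - 4 * (Matrix.det ((Y : GL (Fin 3) K) : Matrix (Fin 3) (Fin 3) K) / 1)) =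
        Valued.v (ϖ ^ (2 * (N - 1) + 1)) ∧
      Valued.v ((1 : K) ^ 2 - (Matrix.trace ((Y : GL (Fin 3) K) : Matrix (Fin 3) (Fin 3) K) - 1) * 1 + Matrix.det ((Y : GL (Fin 3) K) : Matrix (Fin 3) (Fin 3) K) / 1) =
        Valued.v (ϖ ^ (n - 2)) ∧
      ((Y : GL (Fin 3) K) : Matrix (Fin 3) (Fin 3) K) ∈ Algebra.adjoin (ValuativeRel.valuation K).integer
        ({1 + ϖ⁻¹ • (u⁻¹ • ((γ : GL (Fin 3) K) : Matrix (Fin 3) (Fin 3) K) - 1)} : Set (Matrix (Fin 3) (Fin 3) K)) ∧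
      ((((Y : GL (Fin 3) K))⁻¹ : GL (Fin 3) K) : Matrix (Fin 3) (Fin 3) K) ∈ Algebra.adjoin (ValuativeRel.valuation K).integer
        ({1 + ϖ⁻¹ • (u⁻¹ • ((γ : GL (Fin 3) K) : Matrix (Fin 3) (Fin 3) K) - 1)} : Set (Matrix (Fin 3) (Fin 3) K)) ∧
      (1 + ϖ⁻¹ • (u⁻¹ • ((γ : GL (Fin 3) K) : Matrix (Fin 3) (Fin 3) K) - 1)) ∈ Algebra.adjoin (ValuativeRel.valuation K).integer
        ({((Y : GL (Fin 3) K) : Matrix (Fin 3) (Fin 3) K)} : Set (Matrix (Fin 3) (Fin 3) K)) := by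
  have hϖ0 : ϖ ≠ 0 := hd.ϖ_ne_zero
  have hvϖ := hd.vϖ
  obtain ⟨-, hvϖ1, hvm1, -, -, -⟩ := shift_parameter_facts hvϖ
  have h20 : (2 : K) ≠ 0 := fun h0 => by have := hd.v2; rw [h0, map_zero] at this; exact zero_ne_one this
  have hO : ∀ {z : K}, Valued.v z ≤ 1 → z ∈ 𝒪[K] := fun hz => (v_le_one_iff_mem_integer _).1 hz
  have hunit : ∀ {z : K}, Valued.v z = 1 → ∃ d ∈ 𝒪[K], d * z = 1 := fun {z} hz =>
    ⟨z⁻¹, hO (by rw [map_inv₀, hz, inv_one]), inv_mul_cancel₀ fun h0 => by rw [h0, map_zero] at hz; exact zero_ne_one hz⟩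
  set Γ : Matrix (Fin 3) (Fin 3) K := (((γ : ↥(unitaryGroupOfForm σ ((StdForm.antidiagonal 3).over K))) : GL (Fin 3) K) : Matrix (Fin 3) (Fin 3) K) with hΓ
  -- B1-odd: the block-frame data and the odd Cayley block
  obtain ⟨hu1, -, P, b, q, r, s, hPu, hM, RA, Rs, hb, hs1, hq, hr, hN₂, hn₂⟩ := blockFrame_of_typeTwo_odd hd hσO ha₀ hγx hx hN hn hn2 hN1
  have hu0 : u ≠ 0 := fun h0 => by rw [h0, mul_zero] at hu1; exact zero_ne_one hu1
  set g₂ : Matrix (Fin 2) (Fin 2) K := !![1 + 4 * ϖ * b, q; 4 * ϖ * r, s] with hg₂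
  set X₂ : Matrix (Fin 2) (Fin 2) K := ϖ⁻¹ • (g₂ - 1) with hX₂
  set Φ : Matrix (Fin 2) (Fin 2) K := ((2 : K) • (1 : Matrix (Fin 2) (Fin 2) K) + (ϖ + 1) • X₂) * ((2 : K) • (1 : Matrix (Fin 2) (Fin 2) K) + (ϖ - 1) • X₂)⁻¹ with hΦ
  obtain ⟨hX₂int, hm, hp, hdisc, heval⟩ := cayleyBlock_two_odd hd RA Rs hb hs1 hq hr hN1 hn2 hN₂ hn₂ X₂ hX₂ Φ hΦ
  have hmU : IsUnit (((2 : K) • (1 : Matrix (Fin 2) (Fin 2) K) + (ϖ - 1) • X₂).det) :=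
    isUnit_iff_ne_zero.2 fun h0 => by rw [h0, map_zero] at hm; exact zero_ne_one hm
  have hPU : IsUnit P := (Matrix.isUnit_iff_isUnit_det P).2 hPu
  -- the pattern form of the model and the shifted coordinate `W = P·W″·P⁻¹`, `W″ = pattern(X₂, 0)`
  have hPat : (!![1 + 4 * ϖ * b, 0, q; 0, 1, 0; 4 * ϖ * r, 0, s] : Matrix (Fin 3) (Fin 3) K) = !![g₂ 0 0, 0, g₂ 0 1; 0, 1, 0; g₂ 1 0, 0, g₂ 1 1] := by
    rw [hg₂]; ext i j; fin_cases i <;> fin_cases j <;> simp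
  rw [hPat] at hM
  set W : Matrix (Fin 3) (Fin 3) K := ϖ⁻¹ • (u⁻¹ • Γ - 1) with hW
  set W'' : Matrix (Fin 3) (Fin 3) K := !![X₂ 0 0, 0, X₂ 0 1; 0, 0, 0; X₂ 1 0, 0, X₂ 1 1] with hW''
  have hW''e : W'' = ϖ⁻¹ • ((!![g₂ 0 0, 0, g₂ 0 1; 0, 1, 0; g₂ 1 0, 0, g₂ 1 1] : Matrix (Fin 3) (Fin 3) K) - 1) := by
    rw [hW'', hX₂]; ext i j; fin_cases i <;> fin_cases j <;> simp
  have hWconj : W = P * W'' * P⁻¹ := by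
    rw [hW, hM, hW''e, Matrix.mul_smul, Matrix.smul_mul, Matrix.mul_sub, Matrix.sub_mul, Matrix.mul_one, Matrix.mul_nonsing_inv P hPu]
  have hW''int : ∀ i j, W'' i j ∈ 𝒪[K] := by
    intro i j
    refine hO ?_
    rw [hW'']
    fin_cases i <;> fin_cases j <;> simp [hX₂int]
  have hϖO : ϖ ∈ 𝒪[K] := hO hvϖ1.le
  -- the cofactors `N±″ = 2 + (ϖ±1)W″` blockwise; their determinants are units
  have hNm : (2 : K) • (1 : Matrix (Fin 3) (Fin 3) K) + (ϖ - 1) • W'' =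
      !![((2 : K) • (1 : Matrix (Fin 2) (Fin 2) K) + (ϖ - 1) • X₂) 0 0, 0, ((2 : K) • (1 : Matrix (Fin 2) (Fin 2) K) + (ϖ - 1) • X₂) 0 1; 0, 2 + (ϖ - 1) * 0, 0;
        ((2 : K) • (1 : Matrix (Fin 2) (Fin 2) K) + (ϖ - 1) • X₂) 1 0, 0, ((2 : K) • (1 : Matrix (Fin 2) (Fin 2) K) + (ϖ - 1) • X₂) 1 1] := by
    rw [hW'', smul_one_add_smul_cayleyPattern]
  have hNp : (2 : K) • (1 : Matrix (Fin 3) (Fin 3) K) + (ϖ + 1) • W'' =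
      !![((2 : K) • (1 : Matrix (Fin 2) (Fin 2) K) + (ϖ + 1) • X₂) 0 0, 0, ((2 : K) • (1 : Matrix (Fin 2) (Fin 2) K) + (ϖ + 1) • X₂) 0 1; 0, 2 + (ϖ + 1) * 0, 0;
        ((2 : K) • (1 : Matrix (Fin 2) (Fin 2) K) + (ϖ + 1) • X₂) 1 0, 0, ((2 : K) • (1 : Matrix (Fin 2) (Fin 2) K) + (ϖ + 1) • X₂) 1 1] := by
    rw [hW'', smul_one_add_smul_cayleyPattern]
  have hvNm : Valued.v ((2 : K) • (1 : Matrix (Fin 3) (Fin 3) K) + (ϖ - 1) • W'').det = 1 := by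
    rw [hNm, det_cayleyPattern, mul_zero, add_zero, map_mul, hd.v2, hm, one_mul]
  have hvNp : Valued.v ((2 : K) • (1 : Matrix (Fin 3) (Fin 3) K) + (ϖ + 1) • W'').det = 1 := by
    rw [hNp, det_cayleyPattern, mul_zero, add_zero, map_mul, hd.v2, hp, one_mul]
  have hm3 := hunit hvNm
  have hp3 := hunit hvNp
  have hNmU : IsUnit ((2 : K) • (1 : Matrix (Fin 3) (Fin 3) K) + (ϖ - 1) • W'').det :=
    isUnit_iff_ne_zero.2 fun h0 => by rw [h0, map_zero] at hvNm; exact zero_ne_one hvNm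
  have hNpU : ((2 : K) • (1 : Matrix (Fin 3) (Fin 3) K) + (ϖ + 1) • W'').det ≠ 0 := fun h0 => by
    rw [h0, map_zero] at hvNp; exact zero_ne_one hvNp
  -- `Y″ = pattern(Φ, 1) = N₊″ N₋″⁻¹`
  set Y'' : Matrix (Fin 3) (Fin 3) K := !![Φ 0 0, 0, Φ 0 1; 0, 1, 0; Φ 1 0, 0, Φ 1 1] with hY''
  have hΦNm : Φ * ((2 : K) • (1 : Matrix (Fin 2) (Fin 2) K) + (ϖ - 1) • X₂) = (2 : K) • (1 : Matrix (Fin 2) (Fin 2) K) + (ϖ + 1) • X₂ := by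
    rw [hΦ, Matrix.mul_assoc, Matrix.nonsing_inv_mul _ hmU, Matrix.mul_one]
  have hkey : Y'' * ((2 : K) • (1 : Matrix (Fin 3) (Fin 3) K) + (ϖ - 1) • W'') = (2 : K) • (1 : Matrix (Fin 3) (Fin 3) K) + (ϖ + 1) • W'' := by
    rw [hY'', hNm, cayleyPattern_mul, hΦNm, hNp]
    ext i j; fin_cases i <;> fin_cases j <;> simp
  have hE : ((2 : K) • (1 : Matrix (Fin 3) (Fin 3) K) + (ϖ + 1) • W'') * ((2 : K) • (1 : Matrix (Fin 3) (Fin 3) K) + (ϖ - 1) • W'')⁻¹ = Y'' := by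
    rw [← hkey, Matrix.mul_assoc, Matrix.mul_nonsing_inv _ hNmU, Matrix.mul_one]
  have hY''det : Y''.det ≠ 0 := by
    intro h0
    have h := congrArg Matrix.det hkey
    rw [Matrix.det_mul, h0, zero_mul] at h
    exact hNpU h.symm
  -- ★ the three memberships in the block frame
  have h4 := moebius_mem_adjoin 𝒪[K] hW''int hϖO hm3
  have h5 := moebius_inv_mem_adjoin 𝒪[K] hW''int hϖO hm3 hp3
  have h6 := mem_adjoin_moebius 𝒪[K] hW''int hϖO (hunit hd.v2) (hunit hvm1) hm3
  rw [hE] at h4 h5 h6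
  -- `Ym = P Y″ P⁻¹ = φ_ϖ(W)`
  set Ym : Matrix (Fin 3) (Fin 3) K := P * Y'' * P⁻¹ with hYm
  have hcN : ∀ c : K, P * ((2 : K) • (1 : Matrix (Fin 3) (Fin 3) K) + c • W'') * P⁻¹ = (2 : K) • (1 : Matrix (Fin 3) (Fin 3) K) + c • W := fun c => by
    rw [hWconj, Matrix.mul_add, Matrix.add_mul, Matrix.mul_smul, Matrix.smul_mul, Matrix.mul_one, Matrix.mul_nonsing_inv P hPu, Matrix.mul_smul, Matrix.smul_mul]
  have hNmW : IsUnit ((2 : K) • (1 : Matrix (Fin 3) (Fin 3) K) + (ϖ - 1) • W).det := by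
    rw [← hcN, Matrix.det_conj hPU]; exact hNmU
  have hkeyW : Ym * ((2 : K) • (1 : Matrix (Fin 3) (Fin 3) K) + (ϖ - 1) • W) = (2 : K) • (1 : Matrix (Fin 3) (Fin 3) K) + (ϖ + 1) • W := by
    rw [← hcN (ϖ - 1), ← hcN (ϖ + 1), hYm, ← hkey]
    rw [show P * Y'' * P⁻¹ * (P * ((2 : K) • (1 : Matrix (Fin 3) (Fin 3) K) + (ϖ - 1) • W'') * P⁻¹) =
      P * (Y'' * (P⁻¹ * P) * ((2 : K) • (1 : Matrix (Fin 3) (Fin 3) K) + (ϖ - 1) • W'')) * P⁻¹ by simp only [Matrix.mul_assoc],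
      Matrix.nonsing_inv_mul P hPu, Matrix.mul_one]
  have hYφ : Ym = ((2 : K) • (1 : Matrix (Fin 3) (Fin 3) K) + (ϖ + 1) • W) * ((2 : K) • (1 : Matrix (Fin 3) (Fin 3) K) + (ϖ - 1) • W)⁻¹ := by
    rw [← hkeyW, Matrix.mul_nonsing_inv_cancel_right _ _ hNmW]
  -- unitarity of `Ym = φ_ϖ(u⁻¹γ)` (★ the Möbius shift preserves the form; `u⁻¹γ` is unitary as `σu·u = 1`)
  have hγU : (Γ.map σ)ᵀ * (StdForm.antidiagonal 3).over K * Γ = (StdForm.antidiagonal 3).over K := mem_unitaryGroupOfForm_iff.mp γ.2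
  have hMU : ((u⁻¹ • Γ).map σ)ᵀ * (StdForm.antidiagonal 3).over K * (u⁻¹ • Γ) = (StdForm.antidiagonal 3).over K := by
    have e : (u⁻¹ • Γ).map σ = σ u⁻¹ • Γ.map σ := by ext i j; simp
    rw [e, Matrix.transpose_smul, Matrix.smul_mul, Matrix.smul_mul, Matrix.mul_smul, hγU, smul_smul, map_inv₀, ← mul_inv, hu1, inv_one, one_smul]
  have h1W : (1 : Matrix (Fin 3) (Fin 3) K) + ϖ • W = u⁻¹ • Γ := by rw [hW]; exact (eq_one_add_smul_inv_smul_sub_one hϖ0 _).symm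
  have hσp : σ (ϖ + 1) = ϖ + 1 := by rw [map_add, hd.σϖ, map_one]
  have hσm : σ (ϖ - 1) = ϖ - 1 := by rw [map_sub, hd.σϖ, map_one]
  have hD' : IsUnit ((ϖ - 1) • ((1 : Matrix (Fin 3) (Fin 3) K) + ϖ • W) + (ϖ + 1) • (1 : Matrix (Fin 3) (Fin 3) K)).det := by
    have e : (ϖ - 1) • ((1 : Matrix (Fin 3) (Fin 3) K) + ϖ • W) + (ϖ + 1) • (1 : Matrix (Fin 3) (Fin 3) K) =
        ϖ • ((2 : K) • (1 : Matrix (Fin 3) (Fin 3) K) + (ϖ - 1) • W) := by module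
    rw [e, Matrix.det_smul, Fintype.card_fin]
    exact (isUnit_iff_ne_zero.2 (pow_ne_zero 3 hϖ0)).mul hNmW
  have hU : (Ym.map σ)ᵀ * (StdForm.antidiagonal 3).over K * Ym = (StdForm.antidiagonal 3).over K := by
    rw [hYφ, ← moebius_one_add_smul_eq W hϖ0 hNmW]
    exact transpose_map_moebius_mul_mul σ ((StdForm.antidiagonal 3).over K) ((1 : Matrix (Fin 3) (Fin 3) K) + ϖ • W) (by rw [h1W]; exact hMU) hσp hσm hD'
  -- the element `Y ∈ U`
  have hYmdet : Ym.det ≠ 0 := by rw [hYm, Matrix.det_conj hPU]; exact hY''det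
  have hmem : Matrix.GeneralLinearGroup.mkOfDetNeZero Ym hYmdet ∈ unitaryGroupOfForm σ ((StdForm.antidiagonal 3).over K) := by
    rw [mem_unitaryGroupOfForm_iff, Matrix.GeneralLinearGroup.val_mkOfDetNeZero]; exact hU
  obtain ⟨Y, hY⟩ : ∃ Y : ↥(unitaryGroupOfForm σ ((StdForm.antidiagonal 3).over K)), ((Y : GL (Fin 3) K) : Matrix (Fin 3) (Fin 3) K) = Ym :=
    ⟨⟨_, hmem⟩, Matrix.GeneralLinearGroup.val_mkOfDetNeZero _ _⟩
  -- the eigenvector: `Wx = 0`, `N±x = 2x`, `Yx = x`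
  have hWx : W *ᵥ x = 0 := by
    rw [hW, Matrix.smul_mulVec, Matrix.sub_mulVec, Matrix.smul_mulVec, hγx, Matrix.one_mulVec, inv_smul_smul₀ hu0, sub_self, smul_zero]
  have hNx : ∀ c : K, ((2 : K) • (1 : Matrix (Fin 3) (Fin 3) K) + c • W) *ᵥ x = (2 : K) • x := fun c => by
    simp only [Matrix.add_mulVec, Matrix.smul_mulVec, Matrix.one_mulVec, hWx, smul_zero, add_zero]
  have hNinvx : ((2 : K) • (1 : Matrix (Fin 3) (Fin 3) K) + (ϖ - 1) • W)⁻¹ *ᵥ x = (2 : K)⁻¹ • x := by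
    calc ((2 : K) • (1 : Matrix (Fin 3) (Fin 3) K) + (ϖ - 1) • W)⁻¹ *ᵥ x
        = ((2 : K) • (1 : Matrix (Fin 3) (Fin 3) K) + (ϖ - 1) • W)⁻¹ *ᵥ (((2 : K) • (1 : Matrix (Fin 3) (Fin 3) K) + (ϖ - 1) • W) *ᵥ ((2 : K)⁻¹ • x)) := by
          rw [Matrix.mulVec_smul, hNx, inv_smul_smul₀ h20]
      _ = (2 : K)⁻¹ • x := by rw [Matrix.mulVec_mulVec, Matrix.nonsing_inv_mul _ hNmW, Matrix.one_mulVec]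
  have hYx : Ym *ᵥ x = (1 : K) • x := by
    rw [hYφ, ← Matrix.mulVec_mulVec, hNinvx, Matrix.mulVec_smul, hNx, inv_smul_smul₀ h20, one_smul]
  -- trace ∕ determinant ∕ inverse of `Ym` from the block frame
  have htrY : Matrix.trace Ym = Φ.trace + 1 := by
    rw [hYm, Matrix.trace_mul_cycle, Matrix.nonsing_inv_mul P hPu, Matrix.one_mul, hY'', trace_cayleyPattern]
  have hdetY : Matrix.det Ym = 1 * Φ.det := by
    rw [hYm, Matrix.det_conj hPU, hY'', det_cayleyPattern]
  have hYinv : Ym⁻¹ = P * Y''⁻¹ * P⁻¹ := by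
    rw [hYm, Matrix.mul_inv_rev, Matrix.mul_inv_rev, Matrix.nonsing_inv_nonsing_inv P hPu, Matrix.mul_assoc]
  refine ⟨Y, ?_, ?_, ?_, ?_, ?_, ?_⟩
  · rw [hY]; exact hYx
  · rw [hY, htrY, hdetY, show (Φ.trace + 1 - 1) ^ 2 - 4 * (1 * Φ.det / 1) = Φ.trace ^ 2 - 4 * Φ.det by ring]
    exact hdisc
  · rw [hY, htrY, hdetY]
    rw [Matrix.charpoly_fin_two] at heval
    simp only [eval_add, eval_sub, eval_mul, eval_pow, eval_C, eval_X] at heval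
    rw [show (1 : K) ^ 2 - (Φ.trace + 1 - 1) * 1 + 1 * Φ.det / 1 = 1 ^ 2 - Φ.trace * 1 + Φ.det by ring]
    exact heval
  · rw [hY, hYm, adjoin_one_add_eq]
    have h := conj_mem_adjoin_conj _ hPu h4
    rw [← hWconj] at h
    exact h
  · rw [Matrix.coe_units_inv, hY, hYinv, adjoin_one_add_eq]
    have h := conj_mem_adjoin_conj _ hPu h5
    rw [← hWconj] at h
    exact h
  · rw [hY, hYm]
    have h := conj_mem_adjoin_conj _ hPu h6
    rw [← hWconj] at h
    exact Subalgebra.add_mem _ (Subalgebra.one_mem _) h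

/-- **G1 RUNG 2 (R2.d), ODD EDITION.**  For a type-(2) `γ ∈ U(σ, J₀)(K)` with ODD eigenline (`|B₀(x,x)| = |ϖ|^{2k+1}`), anisotropic eigenvalue `u` and exponents `(n, N)`,
`2 ≤ n`, `1 ≤ N` (letters of (R2.c)-odd): `σu·u = 1` exactly, `|u| = 1`, and `χ_γ ≡ (X − u)³ (mod 𝔪)` coefficientwise — in the block frame of B1-odd `γ ∼ u·pattern(g₂, 1)`,
`u·pattern(g₂,1) − u·1 = ϖ·(u·pattern(X₂, 0))` with `X₂` integral, ★ `v_inv_mul_charpoly_coeff_sub_le_one`, `χ_{u·1} = (X − u)³`; the `hχ` of ★ RUNG 1 at `c := u`.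
Binders = ★ B2 (R2.d) with `hx` odd. [cite: Flicker1998UnitaryFL, Theorem 18 p. 97] [cite: Rogawski1990, §4.9 Prop. 4.9.1 (b) p. 55] [cite: Lang2002, Ch. XIV §3 p. 561] -/
theorem norm_eq_one_and_charpoly_congr_of_typeTwo_odd
    [IsDiscreteValuationRing (Valued.integer K)] [Finite (IsLocalRing.ResidueField (Valued.integer K))]
    [IsAdicComplete (IsLocalRing.maximalIdeal (Valued.integer K)) (Valued.integer K)]
    {σ : K →+* K} {ϖ : K} (hd : LocalConjDatum σ ϖ)
    (hσO : ∀ y : Valued.integer K, (σ.comp (Valued.integer K).subtype) y ∈ Valued.integer K)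
    {a₀ : Valued.integer K} (ha₀ : IsUnit (((σ.comp (Valued.integer K).subtype).codRestrict (Valued.integer K) hσO) a₀ - a₀))
    {γ : ↥(unitaryGroupOfForm σ ((StdForm.antidiagonal 3).over K))} {x : Fin 3 → K} {u : K}
    (hγx : (((γ : ↥(unitaryGroupOfForm σ ((StdForm.antidiagonal 3).over K))) : GL (Fin 3) K) : Matrix (Fin 3) (Fin 3) K) *ᵥ x = u • x)
    {k : ℤ} (hx : Valued.v (B₀ σ 3 x x) = WithZero.exp (2 * k + 1))
    {N n : ℕ} (hN : Valued.v ((Matrix.trace (((γ : ↥(unitaryGroupOfForm σ ((StdForm.antidiagonal 3).over K))) : GL (Fin 3) K) : Matrix (Fin 3) (Fin 3) K) - u) ^ 2 -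
      4 * (Matrix.det (((γ : ↥(unitaryGroupOfForm σ ((StdForm.antidiagonal 3).over K))) : GL (Fin 3) K) : Matrix (Fin 3) (Fin 3) K) / u)) = Valued.v (ϖ ^ (2 * N + 1)))
    (hn : Valued.v (u ^ 2 - (Matrix.trace (((γ : ↥(unitaryGroupOfForm σ ((StdForm.antidiagonal 3).over K))) : GL (Fin 3) K) : Matrix (Fin 3) (Fin 3) K) - u) * u +
      Matrix.det (((γ : ↥(unitaryGroupOfForm σ ((StdForm.antidiagonal 3).over K))) : GL (Fin 3) K) : Matrix (Fin 3) (Fin 3) K) / u) = Valued.v (ϖ ^ n))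
    (hn2 : 2 ≤ n) (hN1 : 1 ≤ N) :
    σ u * u = 1 ∧ Valued.v u = 1 ∧
      ∀ i, Valued.v (((((γ : ↥(unitaryGroupOfForm σ ((StdForm.antidiagonal 3).over K))) : GL (Fin 3) K) : Matrix (Fin 3) (Fin 3) K).charpoly - (X - C u) ^ 3).coeff i) < 1 := by
  have hϖ0 : ϖ ≠ 0 := hd.ϖ_ne_zero
  have hvϖ := hd.vϖ
  obtain ⟨-, hvϖ1, -, -, -, -⟩ := shift_parameter_facts hvϖ
  set Γ : Matrix (Fin 3) (Fin 3) K := (((γ : ↥(unitaryGroupOfForm σ ((StdForm.antidiagonal 3).over K))) : GL (Fin 3) K) : Matrix (Fin 3) (Fin 3) K) with hΓ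
  -- B1-odd: the block-frame data and the odd Cayley block (only the integrality of `X₂` is used)
  obtain ⟨hu1, hvu, P, b, q, r, s, hPu, hM, RA, Rs, hb, hs1, hq, hr, hN₂, hn₂⟩ := blockFrame_of_typeTwo_odd hd hσO ha₀ hγx hx hN hn hn2 hN1
  refine ⟨hu1, hvu, fun i => ?_⟩
  have hu0 : u ≠ 0 := fun h0 => by rw [h0, mul_zero] at hu1; exact zero_ne_one hu1
  set g₂ : Matrix (Fin 2) (Fin 2) K := !![1 + 4 * ϖ * b, q; 4 * ϖ * r, s] with hg₂
  set X₂ : Matrix (Fin 2) (Fin 2) K := ϖ⁻¹ • (g₂ - 1) with hX₂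
  obtain ⟨hX₂int, -, -, -, -⟩ := cayleyBlock_two_odd hd RA Rs hb hs1 hq hr hN1 hn2 hN₂ hn₂ X₂ hX₂ _ rfl
  have hPat : (!![1 + 4 * ϖ * b, 0, q; 0, 1, 0; 4 * ϖ * r, 0, s] : Matrix (Fin 3) (Fin 3) K) = !![g₂ 0 0, 0, g₂ 0 1; 0, 1, 0; g₂ 1 0, 0, g₂ 1 1] := by
    rw [hg₂]; ext i j; fin_cases i <;> fin_cases j <;> simp
  have hW''e : (!![X₂ 0 0, 0, X₂ 0 1; 0, 0, 0; X₂ 1 0, 0, X₂ 1 1] : Matrix (Fin 3) (Fin 3) K) =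
      ϖ⁻¹ • ((!![g₂ 0 0, 0, g₂ 0 1; 0, 1, 0; g₂ 1 0, 0, g₂ 1 1] : Matrix (Fin 3) (Fin 3) K) - 1) := by
    rw [hX₂]; ext i j; fin_cases i <;> fin_cases j <;> simp
  -- `χ_γ = χ_{u·pattern(g₂,1)}` (conjugation by the unit `P`)
  obtain ⟨Pu, hPuv⟩ := (Matrix.isUnit_iff_isUnit_det P).2 hPu
  set A : Matrix (Fin 3) (Fin 3) K := u • (!![g₂ 0 0, 0, g₂ 0 1; 0, 1, 0; g₂ 1 0, 0, g₂ 1 1] : Matrix (Fin 3) (Fin 3) K) with hA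
  have hΓA : Γ = (Pu : Matrix (Fin 3) (Fin 3) K) * A * (Pu : Matrix (Fin 3) (Fin 3) K)⁻¹ := by
    rw [hPuv, hA, Matrix.mul_smul, Matrix.smul_mul, ← hPat, ← hM, smul_smul, mul_inv_cancel₀ hu0, one_smul]
  have hχγ : Γ.charpoly = A.charpoly := by rw [hΓA, Matrix.charpoly_units_conj]
  -- `χ_{u·1} = (X − u)³`
  have hχu : ((u • (1 : Matrix (Fin 3) (Fin 3) K))).charpoly = (X - Polynomial.C u) ^ 3 := by
    rw [Matrix.smul_one_eq_diagonal, Matrix.charpoly_diagonal, Finset.prod_const, Finset.card_univ, Fintype.card_fin]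
  -- `A ≡ u·1 (mod ϖ)` entrywise: `ϖ⁻¹(A − u·1) = u·pattern(X₂, 0)` integral
  have hB : IsIntMatrix (u • (1 : Matrix (Fin 3) (Fin 3) K)) := by
    intro i j
    rw [Matrix.smul_apply, Matrix.one_apply, smul_eq_mul]
    split_ifs
    · rw [mul_one, hvu]
    · rw [mul_zero, map_zero]; exact zero_le_one
  have hdiff : ϖ⁻¹ • (A - u • (1 : Matrix (Fin 3) (Fin 3) K)) = u • (!![X₂ 0 0, 0, X₂ 0 1; 0, 0, 0; X₂ 1 0, 0, X₂ 1 1] : Matrix (Fin 3) (Fin 3) K) := by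
    rw [hW''e, hA, ← smul_sub, smul_comm]
  have hAB : IsIntMatrix (ϖ⁻¹ • (A - u • (1 : Matrix (Fin 3) (Fin 3) K))) := by
    rw [hdiff]
    intro i j
    rw [Matrix.smul_apply, smul_eq_mul, map_mul, hvu, one_mul]
    fin_cases i <;> fin_cases j <;> simp [hX₂int]
  have key := v_inv_mul_charpoly_coeff_sub_le_one hB hvϖ1.le hAB i
  rw [Polynomial.coeff_sub, hχγ, ← hχu]
  have e : A.charpoly.coeff i - (u • (1 : Matrix (Fin 3) (Fin 3) K)).charpoly.coeff i =
      ϖ * (ϖ⁻¹ * (A.charpoly.coeff i - (u • (1 : Matrix (Fin 3) (Fin 3) K)).charpoly.coeff i)) := by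
    rw [← mul_assoc, mul_inv_cancel₀ hϖ0, one_mul]
  rw [e, map_mul]
  calc Valued.v ϖ * _ ≤ Valued.v ϖ * 1 := by gcongr
    _ < 1 := by rw [mul_one]; exact hvϖ1

end ShiftOdd

end Summit.HodgeConjecture.HodgeConjecture.R90.S6

end
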